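import Summits.ValiantsHypothesis.ValiantsHypothesis.Theorems.DefinabilityGapCrowdedFree
import HarnessLib

/-!
# Definability gap, ROAD P: the deterministic read-out of Phase A (N1 v2 (e))

Phase A produces a row assignment `r` that (i) obeys the ROW RULE for the threshold `N` (no
curve is assigned a row containing one of its `N`-heavy cells), (ii) leaves at most `B − 1` bad
rows and bad columns in every minor, for every pivot column `s₀`
(`DefinabilityGapPivotGoodUnion.exists_adm_fewBadLines`), and (iii) leaves at least `B` free
positions on every line with at least `n₀` light positions (`DefinabilityGapCrowdedUnion`).
This file reads these three facts out as the two FEW-BAD CLAUSES of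
`DefinabilityGapPivotLiveBad.kiPivotCertificate_of_fewBad` — for EVERY pivot column `s₀` — so
that only the injectivity of the pivots (the alteration stages) remains:

* `le_card_freeCols`, `le_card_freeRows`: `B` free positions on EVERY line (light branch by
  (iii), heavy branch by `le_card_freeCols_of_heavy` when `n₀ + B ≤ m + 1`);
* **`fewBad_clauses`**: the clauses `hcolbad`, `hrowbad` of `kiPivotCertificate_of_fewBad`;
* **`kiPivotCertificate_of_phaseA`**: adding injective pivots in column `s₀` gives the
  certificate.
-/

namespace Summit.ValiantsHypothesis.ValiantsHypothesis.Theorems.DefinabilityGapFewBadReadout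

open Finset
open Literature.Computability.AlgebraicComplexity Literature.Computability.MetaComplexity
open Summit.ValiantsHypothesis.ValiantsHypothesis.Theorems.DefinabilityGapAffineRung
open Summit.ValiantsHypothesis.ValiantsHypothesis.Theorems.DefinabilityGapPivotCertificate
open Summit.ValiantsHypothesis.ValiantsHypothesis.Theorems.DefinabilityGapPivotLive
open Summit.ValiantsHypothesis.ValiantsHypothesis.Theorems.DefinabilityGapPivotLiveWeak
open Summit.ValiantsHypothesis.ValiantsHypothesis.Theorems.DefinabilityGapPivotLiveBad
open Summit.ValiantsHypothesis.ValiantsHypothesis.Theorems.DefinabilityGapPivotAdmissible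
open Summit.ValiantsHypothesis.ValiantsHypothesis.Theorems.DefinabilityGapPivotCrowded
open Summit.ValiantsHypothesis.ValiantsHypothesis.Theorems.DefinabilityGapPivotFreeDict
open Summit.ValiantsHypothesis.ValiantsHypothesis.Theorems.DefinabilityGapCrowdedFree

variable {m : ℕ}

/-- `B` free columns on EVERY row of the block of `c ∈ T`: light branch by hypothesis, heavy
branch by the row rule (`n₀ + B ≤ m + 1`). [this file] -/
theorem le_card_freeCols {T : Finset (Fin 3 → Fin (qOf m))} {r : (Fin 3 → Fin (qOf m)) → Fin m}
    {N n₀ B : ℕ} (hrule : ∀ c' ∈ T, r c' ∉ heavyRows T c' N) (hn₀ : n₀ + B ≤ m + 1)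
    (hfree : ∀ c ∈ T, ∀ i, n₀ ≤ (lightCols T c N i).card → B ≤ (freeCols T c r i).card)
    {c : Fin 3 → Fin (qOf m)} (hc : c ∈ T) (i : Fin m) : B ≤ (freeCols T c r i).card := by
  by_cases h : n₀ ≤ (lightCols T c N i).card
  · exact hfree c hc i h
  · exact le_card_freeCols_of_heavy hrule hc i (by omega)

/-- `B` free rows on EVERY column of the block of `c ∈ T`. [this file] -/
theorem le_card_freeRows {T : Finset (Fin 3 → Fin (qOf m))} {r : (Fin 3 → Fin (qOf m)) → Fin m}
    {N n₀ B : ℕ} (hrule : ∀ c' ∈ T, r c' ∉ heavyRows T c' N) (hn₀ : n₀ + B ≤ m + 1)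
    (hfree : ∀ c ∈ T, ∀ j, n₀ ≤ (lightRows T c N j).card → B ≤ (freeRows T c r j).card)
    {c : Fin 3 → Fin (qOf m)} (hc : c ∈ T) (j : Fin m) : B ≤ (freeRows T c r j).card := by
  by_cases h : n₀ ≤ (lightRows T c N j).card
  · exact hfree c hc j h
  · exact le_card_freeRows_of_heavy hrule hc j (by omega)

/-- **The few-bad clauses from Phase A.**  Row rule for threshold `N`; at most `B − 1` bad rows
and bad columns in every minor for the pivot column `s₀`; at least `B` free positions on every
line with at least `n₀` light positions; `n₀ + B ≤ m + 1`.  Then the hypotheses `hcolbad` and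
`hrowbad` of `kiPivotCertificate_of_fewBad` hold for `(s₀, r)`. [this file] -/
theorem fewBad_clauses (T : Finset (Fin 3 → Fin (qOf m))) (s₀ : Fin m)
    (r : (Fin 3 → Fin (qOf m)) → Fin m) {N n₀ B : ℕ}
    (hrule : ∀ c' ∈ T, r c' ∉ heavyRows T c' N) (hn₀ : n₀ + B ≤ m + 1)
    (hbadR : ∀ c ∈ T, (badRows (pivotZeros m T s₀ r) c (r c) s₀).card + 1 ≤ B)
    (hbadC : ∀ c ∈ T, (badCols (pivotZeros m T s₀ r) c (r c) s₀).card + 1 ≤ B)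
    (hfreeR : ∀ c ∈ T, ∀ i, n₀ ≤ (lightCols T c N i).card → B ≤ (freeCols T c r i).card)
    (hfreeC : ∀ c ∈ T, ∀ j, n₀ ≤ (lightRows T c N j).card → B ≤ (freeRows T c r j).card) :
    (∀ c ∈ T, ∀ j ∈ badCols (pivotZeros m T s₀ r) c (r c) s₀,
        (badCols (pivotZeros m T s₀ r) c (r c) s₀).card ≤
          (okRows (pivotZeros m T s₀ r) c (r c) j).card) ∧
      (∀ c ∈ T, ∀ i ∈ badRows (pivotZeros m T s₀ r) c (r c) s₀,
        (badRows (pivotZeros m T s₀ r) c (r c) s₀).card +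
          (deadCols (pivotZeros m T s₀ r) c s₀ i).card + 1 ≤ m) := by
  refine ⟨fun c hc j _ => ?_, fun c hc i hi => ?_⟩
  · exact badCol_clause_of_free T s₀ r c j (freeRows T c r j) (fun a ha => mem_freeRows.mp ha)
      ((hbadC c hc).trans (le_card_freeRows hrule hn₀ hfreeC hc j))
  · exact badRow_clause_of_free T s₀ r c (mem_badRows.mp hi).1 (freeCols T c r i)
      (fun j hj => mem_freeCols.mp hj)
      ((hbadR c hc).trans (le_card_freeCols hrule hn₀ hfreeR hc i))

/-- **Certificate from Phase A plus injective pivots.**  Under the hypotheses of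
`fewBad_clauses`, injectivity of the pivots `cellEmb c (r c, s₀)` on `T` yields
`KIPivotCertificate m T s₀ r`. [this file] -/
theorem kiPivotCertificate_of_phaseA (T : Finset (Fin 3 → Fin (qOf m))) (s₀ : Fin m)
    (r : (Fin 3 → Fin (qOf m)) → Fin m) {N n₀ B : ℕ}
    (hrule : ∀ c' ∈ T, r c' ∉ heavyRows T c' N) (hn₀ : n₀ + B ≤ m + 1)
    (hbadR : ∀ c ∈ T, (badRows (pivotZeros m T s₀ r) c (r c) s₀).card + 1 ≤ B)
    (hbadC : ∀ c ∈ T, (badCols (pivotZeros m T s₀ r) c (r c) s₀).card + 1 ≤ B)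
    (hfreeR : ∀ c ∈ T, ∀ i, n₀ ≤ (lightCols T c N i).card → B ≤ (freeCols T c r i).card)
    (hfreeC : ∀ c ∈ T, ∀ j, n₀ ≤ (lightRows T c N j).card → B ≤ (freeRows T c r j).card)
    (hinj : ∀ c ∈ T, ∀ c' ∈ T, cellEmb m c (r c, s₀) = cellEmb m c' (r c', s₀) → c = c') :
    KIPivotCertificate m T s₀ r := by
  obtain ⟨hcol, hrow⟩ := fewBad_clauses T s₀ r hrule hn₀ hbadR hbadC hfreeR hfreeC
  exact kiPivotCertificate_of_fewBad T s₀ r hinj hcol hrow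

end Summit.ValiantsHypothesis.ValiantsHypothesis.Theorems.DefinabilityGapFewBadReadout
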